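import Literature.NumberTheory.Transcendental.NesterenkoEliminationK
import Literature.NumberTheory.Transcendental.NesterenkoEliminationLocalizationK
import Literature.NumberTheory.Transcendental.NesterenkoEliminationPrimaryFormK
import Literature.NumberTheory.Transcendental.NesterenkoChowFormDistinctK
import Literature.NumberTheory.Transcendental.NesterenkoEliminationChowFormK
import Literature.NumberTheory.Transcendental.NesterenkoEliminationProp47Proofs
import Mathlib.RingTheory.MvPolynomial.WeightedHomogeneous
import Literature.NumberTheory.Transcendental.NesterenkoEliminationProofs
import Literature.NumberTheory.Transcendental.NesterenkoSymbolicPowers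
import Literature.RingTheory.MvPolynomial.EquidimensionalHilbert
import Literature.RingTheory.GradedAlgebra.HomogeneousAssociatedPrimes
import HarnessLib

/-!
# LNM 1752 Ch. 3 Proposition 4.4 over an ARBITRARY field of characteristic zero — proofs only

`Literature/NumberTheory/Transcendental/NesterenkoEliminationProp44K.lean`. The tree discharges
Nesterenko's Proposition 4.4 (Nesterenko–Philippon (eds.), LNM 1752 (2001), Ch. 3 §4, p. 38: for a
homogeneous unmixed ideal `I` with `dim I = r − 1`, `Ī(r)` is principal, generated by
`F = F₁^{k₁} ⋯ F_s^{k_s}` with `F_j` the irreducible generators of the `p̄_j(r)` and `k_j` the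
exponents of the primary components, and `F` has the same degree in every block `uᵢ`) for
`K = ℚ` (`Nesterenko.NesterenkoPhilippon2001_ch3_prop_4_4_holds`, `NesterenkoEliminationProp44Holds.lean`).
Chapter 10 runs Ch. 3 §4 over `K = ℂ(z)` (p. 153: "The field `K` is in our case `ℂ(z)`";
Prop. 3.6 and §4 of Ch. 10 use Prop. 4.4/4.7 there), so this file proves **the same statement over
an arbitrary field `K` of characteristic zero** — `NesterenkoK.prop_4_4` — for the generic objects
`NesterenkoK.{elimIdeal, chowForm, blockDeg, ideg, IsUnmixedOfRank, primaryExponent}`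
(`NesterenkoElimIdealPrime.lean`, `NesterenkoEliminationK.lean`), assembling the generic inputs

* h1a `NesterenkoK.isPrime_elimIdeal` (`NesterenkoElimIdealPrime.lean`),
  h1b `NesterenkoK.elimIdeal_eq_iInf_of_isMinimalPrimaryDecomposition`
  (`NesterenkoEliminationLocalizationK.lean`; Philippon 1986 Prop. 1.3 (iv)),
* h2 `NesterenkoK.isPrincipal_elimIdeal` (`NesterenkoChowFormPrime.lean`),
* h3 `NesterenkoK.elimIdeal_eq_span_pow_of_isPrimary` (`NesterenkoEliminationPrimaryFormK.lean`),
* h4 `NesterenkoK.eq_of_elimIdeal_eq` (`NesterenkoChowFormDistinctK.lean`),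

and derives **Proposition 4.7 (1)** over `K` (`sum_primaryExponent_mul_ideg_eq`: `∑ k_Q deg √Q = deg I`,
through the multihomogeneity of the associated form, `NesterenkoEliminationChowFormK.lean`),
exactly as `Nesterenko.NesterenkoPhilippon2001_ch3_prop_4_4_of` does over `ℚ` (the glue is that
file's, with `ℚ ↦ K`: the radicals of the components are the associated primes, homogeneous of
dimension `r − 1`; the `F_j` are pairwise non-associated primes of the factorial ring `K[U]`, so
`Ī(r) = ⋂ (F_j^{k_j}) = (∏ F_j^{k_j})`; the primary components of a homogeneous unmixed ideal are
isolated hence homogeneous, `isHomogeneous_of_mem_isMinimalPrimaryDecomposition`). The symmetry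
clause (`blockDeg_chowForm_eq_ideg`: `Ī(r)` is stable under permutations of the blocks, so the
generator is associated with its permutations) is proved for any field. Characteristic zero enters
only through h3 (the exponent law differentiates `f^{a+1}`).

## References

* [NesterenkoPhilippon2001] Yu. V. Nesterenko, P. Philippon (eds.), *Introduction to Algebraic
  Independence Theory*, LNM 1752, Springer 2001, Ch. 3 §4 Prop. 4.4 and the paragraph after it,
  Def. 4.5 (p. 38), Prop. 4.7 (1) (p. 39); Ch. 10 §2 (p. 153), Prop. 3.6 (p. 157), §4 (p. 161).
* [Philippon1986Criteres] P. Philippon, Publ. Math. IHÉS 64 (1986), §1 Prop. 1.3, 1.5.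
* W. V. D. Hodge, D. Pedoe, *Methods of Algebraic Geometry* II, Ch. X §§6–7.
-/

noncomputable section

open MvPolynomial

namespace Literature.NumberTheory.Transcendental

namespace NesterenkoK

variable {K : Type*} [Field K] {m : ℕ}

/-! ### Symmetry of `Ī(r)` under permutations of the blocks `u₁, …, u_r` -/

section Symmetry

variable {r : ℕ}

/-- Permuting the blocks permutes the linear forms: `σ · Lᵢ = L_{σ i}`. [folklore] -/
theorem rename_sumCongr_linForm (σ : Equiv.Perm (Fin r)) (i : Fin r) :
    rename (Equiv.sumCongr (Equiv.prodCongr σ (Equiv.refl (Fin (m + 1)))) (Equiv.refl (Fin (m + 1))))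
      (linForm K r m i) = linForm K r m (σ i) := by
  simp [linForm, map_sum]

/-- `(I, L₁, …, L_r)` is stable under permuting the blocks. [folklore] -/
theorem rename_sumCongr_mem_extIdeal {I : Ideal (MvPolynomial (Fin (m + 1)) K)}
    (σ : Equiv.Perm (Fin r)) {P : MvPolynomial ((Fin r × Fin (m + 1)) ⊕ Fin (m + 1)) K}
    (hP : P ∈ extIdeal I r) :
    rename (Equiv.sumCongr (Equiv.prodCongr σ (Equiv.refl (Fin (m + 1)))) (Equiv.refl (Fin (m + 1))))
      P ∈ extIdeal I r := by
  have hle : extIdeal I r ≤ (extIdeal I r).comap (rename (Equiv.sumCongr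
      (Equiv.prodCongr σ (Equiv.refl (Fin (m + 1)))) (Equiv.refl (Fin (m + 1))))) := by
    refine sup_le ?_ ?_
    · rw [Ideal.map_le_iff_le_comap]
      intro p hp
      rw [Ideal.mem_comap, Ideal.mem_comap, rename_rename]
      have : ((Equiv.sumCongr (Equiv.prodCongr σ (Equiv.refl (Fin (m + 1)))) (Equiv.refl (Fin (m + 1)))) ∘
          Sum.inr : Fin (m + 1) → (Fin r × Fin (m + 1)) ⊕ Fin (m + 1)) = Sum.inr := by
        funext j; simp
      rw [this]
      exact Ideal.mem_sup_left (Ideal.mem_map_of_mem _ hp)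
    · rw [Ideal.span_le]
      rintro _ ⟨i, rfl⟩
      rw [SetLike.mem_coe, Ideal.mem_comap, rename_sumCongr_linForm]
      exact Ideal.mem_sup_right (Ideal.subset_span ⟨σ i, rfl⟩)
  exact hle hP

/-- `(I, L₁, …, L_r)` is stable under permuting the blocks (iff form). [folklore] -/
theorem rename_sumCongr_mem_extIdeal_iff {I : Ideal (MvPolynomial (Fin (m + 1)) K)}
    (σ : Equiv.Perm (Fin r)) (P : MvPolynomial ((Fin r × Fin (m + 1)) ⊕ Fin (m + 1)) K) :
    rename (Equiv.sumCongr (Equiv.prodCongr σ (Equiv.refl (Fin (m + 1)))) (Equiv.refl (Fin (m + 1))))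
      P ∈ extIdeal I r ↔ P ∈ extIdeal I r := by
  refine ⟨fun h => ?_, rename_sumCongr_mem_extIdeal σ⟩
  have := rename_sumCongr_mem_extIdeal σ⁻¹ h
  rw [rename_rename] at this
  have hid : ((Equiv.sumCongr (Equiv.prodCongr σ⁻¹ (Equiv.refl (Fin (m + 1)))) (Equiv.refl (Fin (m + 1)))) ∘
      (Equiv.sumCongr (Equiv.prodCongr σ (Equiv.refl (Fin (m + 1)))) (Equiv.refl (Fin (m + 1)))) :
        (Fin r × Fin (m + 1)) ⊕ Fin (m + 1) → (Fin r × Fin (m + 1)) ⊕ Fin (m + 1)) = id := by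
    funext x
    rcases x with ⟨i, j⟩ | j <;> simp
  rwa [hid, rename_id] at this

/-- `Ī(r)` is stable under permuting the blocks `u₁, …, u_r`.
[cite: NesterenkoPhilippon2001, Ch. 3, paragraph after Prop. 4.4 (p. 38)] -/
theorem rename_prodCongr_mem_elimIdeal_iff {I : Ideal (MvPolynomial (Fin (m + 1)) K)}
    (σ : Equiv.Perm (Fin r)) (G : MvPolynomial (Fin r × Fin (m + 1)) K) :
    rename (Equiv.prodCongr σ (Equiv.refl (Fin (m + 1)))) G ∈ elimIdeal I r ↔ G ∈ elimIdeal I r := by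
  have key : ∀ (M : ℕ) (j : Fin (m + 1)),
      rename Sum.inl (rename (Equiv.prodCongr σ (Equiv.refl (Fin (m + 1)))) G) *
          (X (Sum.inr j) : MvPolynomial ((Fin r × Fin (m + 1)) ⊕ Fin (m + 1)) K) ^ M =
        rename (Equiv.sumCongr (Equiv.prodCongr σ (Equiv.refl (Fin (m + 1)))) (Equiv.refl (Fin (m + 1))))
          (rename Sum.inl G * X (Sum.inr j) ^ M) := by
    intro M j
    rw [map_mul, map_pow, rename_X, rename_rename, rename_rename]
    have : ((Equiv.sumCongr (Equiv.prodCongr σ (Equiv.refl (Fin (m + 1)))) (Equiv.refl (Fin (m + 1)))) ∘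
        Sum.inl : Fin r × Fin (m + 1) → (Fin r × Fin (m + 1)) ⊕ Fin (m + 1)) =
        Sum.inl ∘ (Equiv.prodCongr σ (Equiv.refl (Fin (m + 1)))) := by
      funext p; simp
    rw [this]
    simp
  simp only [mem_elimIdeal_iff, key, rename_sumCongr_mem_extIdeal_iff]

/-- `σ · Ī(r) = Ī(r)` as ideals of `K[U]`. [cite: NesterenkoPhilippon2001, Ch. 3, paragraph after Prop. 4.4 (p. 38)] -/
theorem map_rename_prodCongr_elimIdeal (I : Ideal (MvPolynomial (Fin (m + 1)) K))
    (σ : Equiv.Perm (Fin r)) :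
    (elimIdeal I r).map (rename (Equiv.prodCongr σ (Equiv.refl (Fin (m + 1))))) = elimIdeal I r := by
  apply le_antisymm
  · rw [Ideal.map_le_iff_le_comap]
    intro G hG
    rw [Ideal.mem_comap]
    exact (rename_prodCongr_mem_elimIdeal_iff σ G).2 hG
  · intro G hG
    have hG' : rename (Equiv.prodCongr σ⁻¹ (Equiv.refl (Fin (m + 1)))) G ∈ elimIdeal I r :=
      (rename_prodCongr_mem_elimIdeal_iff σ⁻¹ G).2 hG
    have e : rename (Equiv.prodCongr σ (Equiv.refl (Fin (m + 1))))
        (rename (Equiv.prodCongr σ⁻¹ (Equiv.refl (Fin (m + 1)))) G) = G := by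
      rw [rename_rename]
      have : ((Equiv.prodCongr σ (Equiv.refl (Fin (m + 1)))) ∘
          (Equiv.prodCongr σ⁻¹ (Equiv.refl (Fin (m + 1)))) : Fin r × Fin (m + 1) → Fin r × Fin (m + 1)) =
          id := by
        funext ⟨i, j⟩; simp
      rw [this, rename_id]
      rfl
    rw [← e]
    exact Ideal.mem_map_of_mem _ hG'

/-- The degree in the block `uᵢ` of `F ∘ σ` is the degree of `F` in the block `u_{σ⁻¹ i}`.
[folklore] -/
theorem blockDeg_rename_prodCongr (σ : Equiv.Perm (Fin r)) (F : MvPolynomial (Fin r × Fin (m + 1)) K)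
    (i : Fin r) :
    blockDeg (rename (Equiv.prodCongr σ (Equiv.refl (Fin (m + 1)))) F) i = blockDeg F (σ.symm i) := by
  classical
  unfold blockDeg
  rw [support_rename_of_injective (Equiv.prodCongr σ (Equiv.refl (Fin (m + 1)))).injective,
    Finset.sup_image]
  congr 1
  funext d
  simp only [Function.comp_apply]
  refine Finset.sum_congr rfl fun j _ => ?_
  rw [Finsupp.mapDomain_equiv_apply]
  simp

/-- Multiplying by a non-zero constant does not change block degrees. [folklore] -/
theorem blockDeg_mul_C (F : MvPolynomial (Fin r × Fin (m + 1)) K) {c : K} (hc : c ≠ 0) (i : Fin r) :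
    blockDeg (F * C c) i = blockDeg F i := by
  unfold blockDeg
  rw [mul_comm, ← smul_eq_C_mul, support_smul_eq hc]

/-- The associated form is symmetric in `u₁, …, u_r` up to a unit: all its block degrees agree
(in the junk case `Ī(r)` not principal both sides vanish).
[cite: NesterenkoPhilippon2001, Ch. 3, paragraph after Prop. 4.4 (p. 38)] -/
theorem blockDeg_chowForm_eq (I : Ideal (MvPolynomial (Fin (m + 1)) K)) (i i' : Fin r) :
    blockDeg (chowForm I r) i = blockDeg (chowForm I r) i' := by
  classical
  by_cases h : (elimIdeal I r).IsPrincipal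
  · set F := chowForm I r with hF
    have hspan : Ideal.span {F} = elimIdeal I r := span_chowForm I r h
    set σ : Equiv.Perm (Fin r) := Equiv.swap i i' with hσ
    have hspan' : Ideal.span {rename (Equiv.prodCongr σ (Equiv.refl (Fin (m + 1)))) F} =
        elimIdeal I r := by
      rw [← Set.image_singleton, ← Ideal.map_span, hspan, map_rename_prodCongr_elimIdeal]
    have hass : Associated (rename (Equiv.prodCongr σ (Equiv.refl (Fin (m + 1)))) F) F := by
      rw [← Ideal.span_singleton_eq_span_singleton, hspan, hspan']
    obtain ⟨u, hu⟩ := hass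
    obtain ⟨c, hc, hcu⟩ := (MvPolynomial.isUnit_iff_eq_C_of_isReduced).1 u.isUnit
    have hc0 : c ≠ 0 := hc.ne_zero
    calc blockDeg F i = blockDeg F (σ.symm i') := by simp [hσ]
      _ = blockDeg (rename (Equiv.prodCongr σ (Equiv.refl (Fin (m + 1)))) F) i' :=
          (blockDeg_rename_prodCongr σ F i').symm
      _ = blockDeg (rename (Equiv.prodCongr σ (Equiv.refl (Fin (m + 1)))) F * C c) i' :=
          (blockDeg_mul_C _ hc0 i').symm
      _ = blockDeg F i' := by rw [← hcu, hu]
  · have h0 : chowForm I r = 0 := by rw [chowForm, dif_neg h]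
    simp [h0]

/-- **The symmetry clause of Prop. 4.4** over any field: all block degrees `deg_{uᵢ} F` of the
associated form equal `deg I = deg_{u₁} F`.
[cite: NesterenkoPhilippon2001, Ch. 3, paragraph after Prop. 4.4 and Def. 4.5 (p. 38)] -/
theorem blockDeg_chowForm_eq_ideg (I : Ideal (MvPolynomial (Fin (m + 1)) K)) (hr : 0 < r) (i : Fin r) :
    blockDeg (chowForm I r) i = ideg I r := by
  rw [ideg, dif_pos hr]
  exact blockDeg_chowForm_eq I i ⟨0, hr⟩

end Symmetry

/-! ### Primary components of a homogeneous unmixed ideal are isolated, hence homogeneous -/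

attribute [local instance] MvPolynomial.gradedAlgebra

/-- In a minimal primary decomposition of an ideal all of whose associated primes have the same
(finite) dimension, no radical of a component lies inside the radical of another component.
[folklore] -/
theorem not_radical_le_radical_of_isUnmixedOfRank {I : Ideal (MvPolynomial (Fin (m + 1)) K)} {r : ℕ}
    (hunm : IsUnmixedOfRank I r) {t : Finset (Ideal (MvPolynomial (Fin (m + 1)) K))}
    (ht : Submodule.IsMinimalPrimaryDecomposition I t) {Q Q' : Ideal (MvPolynomial (Fin (m + 1)) K)}
    (hQ : Q ∈ t) (hQ' : Q' ∈ t) (hne : Q' ≠ Q) : ¬ Q'.radical ≤ Q.radical := by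
  intro hle
  have hrad : ∀ P ∈ t, P.radical ∈ I.associatedPrimes := fun P hP => by
    have h := ht.mem_associatedPrimes hP
    rwa [Submodule.colon_univ] at h
  haveI : Q'.radical.IsPrime := Ideal.isPrime_radical (ht.primary hQ')
  haveI : Q.radical.IsPrime := Ideal.isPrime_radical (ht.primary hQ)
  have heq : Q'.radical = Q.radical :=
    Literature.RingTheory.MvPolynomial.eq_of_le_of_ringKrullDim_quotient_eq hle
      (hunm.2 _ (hrad Q' hQ')) (hunm.2 _ (hrad Q hQ))
  refine ht.distinct (Finset.mem_coe.mpr hQ') (Finset.mem_coe.mpr hQ) hne ?_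
  show (Submodule.colon Q' Set.univ).radical = (Submodule.colon Q Set.univ).radical
  rw [Submodule.colon_univ, Submodule.colon_univ]
  exact heq

/-- **Isolated components**: for a component `Q` of a minimal primary decomposition of an unmixed
ideal `I` and `a ∈ Q` there is `s ∉ √Q` with `s a ∈ I`. [folklore] -/
theorem exists_notMem_radical_mul_mem {I : Ideal (MvPolynomial (Fin (m + 1)) K)} {r : ℕ}
    (hunm : IsUnmixedOfRank I r) {t : Finset (Ideal (MvPolynomial (Fin (m + 1)) K))}
    (ht : Submodule.IsMinimalPrimaryDecomposition I t) {Q : Ideal (MvPolynomial (Fin (m + 1)) K)}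
    (hQ : Q ∈ t) {a : MvPolynomial (Fin (m + 1)) K} (ha : a ∈ Q) :
    ∃ s ∉ Q.radical, s * a ∈ I := by
  classical
  haveI hP : Q.radical.IsPrime := Ideal.isPrime_radical (ht.primary hQ)
  have hex : ∀ Q' ∈ t.erase Q, ∃ s ∉ Q.radical, s ∈ Q' := by
    intro Q' hQ'
    obtain ⟨hne, hQ't⟩ := Finset.mem_erase.mp hQ'
    obtain ⟨x, hx, hxnot⟩ :=
      Set.not_subset.mp (not_radical_le_radical_of_isUnmixedOfRank hunm ht hQ hQ't hne)
    obtain ⟨n, hn⟩ := hx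
    exact ⟨x ^ n, fun h => hxnot (hP.mem_of_pow_mem n h), hn⟩
  choose! s hs using hex
  refine ⟨∏ Q' ∈ t.erase Q, s Q', ?_, ?_⟩
  · intro hmem
    obtain ⟨Q', hQ', h⟩ := Ideal.IsPrime.prod_mem_iff.mp hmem
    exact (hs Q' hQ').1 h
  · have hI : I = t.inf id := ht.inf_eq.symm
    rw [hI, Submodule.mem_finsetInf]
    intro Q' hQ't
    by_cases hQQ : Q' = Q
    · subst hQQ
      exact Ideal.mul_mem_left _ _ ha
    · have hQ' : Q' ∈ t.erase Q := Finset.mem_erase.mpr ⟨hQQ, hQ't⟩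
      rw [← Finset.mul_prod_erase _ _ hQ']
      exact Ideal.mul_mem_right _ _ (Ideal.mul_mem_right _ _ (hs Q' hQ').2)

/-- **The primary components of a homogeneous unmixed ideal are homogeneous** (Zariski–Samuel II,
Ch. VII §2, Thm. 9 and Cor.; Bruns–Herzog Lemma 1.5.6): each component is isolated, so it equals
its (primary) homogeneous core. [folklore] -/
theorem isHomogeneous_of_mem_isMinimalPrimaryDecomposition {I : Ideal (MvPolynomial (Fin (m + 1)) K)}
    {r : ℕ} (hI : I.IsHomogeneous (homogeneousSubmodule (Fin (m + 1)) K)) (hunm : IsUnmixedOfRank I r)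
    {t : Finset (Ideal (MvPolynomial (Fin (m + 1)) K))} (ht : Submodule.IsMinimalPrimaryDecomposition I t)
    {Q : Ideal (MvPolynomial (Fin (m + 1)) K)} (hQ : Q ∈ t) :
    Q.IsHomogeneous (homogeneousSubmodule (Fin (m + 1)) K) := by
  classical
  set Qh : Ideal (MvPolynomial (Fin (m + 1)) K) :=
    (Q.homogeneousCore (homogeneousSubmodule (Fin (m + 1)) K)).toIdeal with hQh
  have hle : Qh ≤ Q := Ideal.toIdeal_homogeneousCore_le _ Q
  have hIQ : I ≤ Q := by
    rw [← ht.inf_eq]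
    exact Finset.inf_le (f := id) hQ
  have hIQh : I ≤ Qh := by
    rw [← hI.toIdeal_homogeneousCore_eq_self, hQh]
    exact Ideal.homogeneousCore_mono _ hIQ
  have hprim : Qh.IsPrimary := Nesterenko.isPrimary_homogeneousCore (ht.primary hQ)
  suffices hQeq : Q = Qh by
    rw [hQeq, hQh]
    exact (Q.homogeneousCore (homogeneousSubmodule (Fin (m + 1)) K)).isHomogeneous
  refine le_antisymm (fun a ha => ?_) hle
  obtain ⟨s, hs, hsa⟩ := exists_notMem_radical_mul_mem hunm ht hQ ha
  rcases (Ideal.isPrimary_iff.mp hprim).2 (show a * s ∈ Qh by rw [mul_comm]; exact hIQh hsa) with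
    h | h
  · exact h
  · exact absurd (Ideal.radical_mono hle h) hs

/-! ### Proposition 4.4 over any field of characteristic zero -/

/-- **LNM 1752, Ch. 3, Proposition 4.4 over an arbitrary field `K` of characteristic zero**
(with the remark following it). Let `I ⊂ K[x₀, …, x_m]` be a homogeneous unmixed ideal with
`dim I = r − 1` (`1 ≤ r ≤ m`), `I = I₁ ∩ … ∩ I_s` a reduced primary decomposition, `𝔭_j = √I_j`,
`k_j` the exponent of `I_j`. Then `Ī(r)` is a principal ideal of `K[U]`, each `p̄_j(r)` is
principal, and if `p̄_j(r) = (F_j)` then the `F_j` are irreducible and `F = F₁^{k₁} ⋯ F_s^{k_s}`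
generates `Ī(r)`; moreover all the block degrees `deg_{uᵢ}` of the associated form equal
`deg I`. The statement is `Nesterenko.NesterenkoPhilippon2001_ch3_prop_4_4` with `ℚ ↦ K`; the
proof is the glue of `Nesterenko.NesterenkoPhilippon2001_ch3_prop_4_4_of` fed with the generic
inputs h1–h4 (see the module docstring).
[cite: NesterenkoPhilippon2001, Ch. 3 Prop. 4.4 and the following paragraph (p. 38)] -/
theorem prop_4_4 [CharZero K] (m r : ℕ) (I : Ideal (MvPolynomial (Fin (m + 1)) K)) (hr : 1 ≤ r)
    (hrm : r ≤ m) (hI : I.IsHomogeneous (homogeneousSubmodule (Fin (m + 1)) K))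
    (hunm : IsUnmixedOfRank I r) (t : Finset (Ideal (MvPolynomial (Fin (m + 1)) K)))
    (ht : Submodule.IsMinimalPrimaryDecomposition I t) :
    (elimIdeal I r).IsPrincipal ∧
      (∀ Q ∈ t, (elimIdeal Q.radical r).IsPrincipal) ∧
      (∀ F : Ideal (MvPolynomial (Fin (m + 1)) K) → MvPolynomial (Fin r × Fin (m + 1)) K,
        (∀ Q ∈ t, Ideal.span {F Q} = elimIdeal Q.radical r) →
          (∀ Q ∈ t, Irreducible (F Q)) ∧
            Ideal.span {∏ Q ∈ t, F Q ^ primaryExponent Q} = elimIdeal I r) ∧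
      (∀ i : Fin r, blockDeg (chowForm I r) i = ideg I r) := by
  classical
  haveI : Infinite K := Infinite.of_injective _ Nat.cast_injective
  -- the radicals of the components are the associated primes of `I`
  have hrad : ∀ Q ∈ t, Q.radical ∈ I.associatedPrimes := fun Q hQ => by
    have h := ht.mem_associatedPrimes hQ
    rwa [Submodule.colon_univ] at h
  have hprime : ∀ Q ∈ t, Q.radical.IsPrime := fun Q hQ => Ideal.isPrime_radical (ht.primary hQ)
  have hdim : ∀ Q ∈ t, ringKrullDim (MvPolynomial (Fin (m + 1)) K ⧸ Q.radical) = r :=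
    fun Q hQ => hunm.2 _ (hrad Q hQ)
  have hhom : ∀ Q ∈ t, Q.radical.IsHomogeneous (homogeneousSubmodule (Fin (m + 1)) K) :=
    fun Q hQ => Literature.RingTheory.GradedAlgebra.isHomogeneous_of_mem_associatedPrimes
      (homogeneousSubmodule (Fin (m + 1)) K) hI (hrad Q hQ)
  have helimPrime : ∀ Q ∈ t, (elimIdeal Q.radical r).IsPrime := fun Q hQ => by
    haveI := hprime Q hQ
    obtain ⟨c, hc⟩ := exists_X_notMem_of_rank (hprime Q hQ) hr (hdim Q hQ)
    exact isPrime_elimIdeal Q.radical hc r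
  have hprinc : ∀ Q ∈ t, (elimIdeal Q.radical r).IsPrincipal ∧ elimIdeal Q.radical r ≠ ⊥ :=
    fun Q hQ => by
      haveI := hprime Q hQ
      obtain ⟨h1, h2, -⟩ := isPrincipal_elimIdeal Q.radical (hhom Q hQ) hr (hdim Q hQ)
      exact ⟨h1, h2⟩
  -- generators of the `p̄_j(r)` are prime elements, pairwise non-associated
  have hgenPrime : ∀ F : Ideal (MvPolynomial (Fin (m + 1)) K) → MvPolynomial (Fin r × Fin (m + 1)) K,
      (∀ Q ∈ t, Ideal.span {F Q} = elimIdeal Q.radical r) → ∀ Q ∈ t, Prime (F Q) := by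
    intro F hF Q hQ
    have hF0 : F Q ≠ 0 := by
      intro h0
      apply (hprinc Q hQ).2
      rw [← hF Q hQ, h0, Ideal.span_singleton_eq_bot]
    rw [← Ideal.span_singleton_prime hF0, hF Q hQ]
    exact helimPrime Q hQ
  have hgenNotDvd : ∀ F : Ideal (MvPolynomial (Fin (m + 1)) K) → MvPolynomial (Fin r × Fin (m + 1)) K,
      (∀ Q ∈ t, Ideal.span {F Q} = elimIdeal Q.radical r) →
        ∀ Q ∈ t, ∀ Q' ∈ t, Q ≠ Q' → ¬ F Q ∣ F Q' := by
    intro F hF Q hQ Q' hQ' hne hdvd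
    have hass : Associated (F Q) (F Q') :=
      (hgenPrime F hF Q hQ).irreducible.associated_of_dvd (hgenPrime F hF Q' hQ').irreducible hdvd
    have hspan : Ideal.span {F Q} = Ideal.span {F Q'} :=
      Ideal.span_singleton_eq_span_singleton.2 hass
    rw [hF Q hQ, hF Q' hQ'] at hspan
    have heq : Q.radical = Q'.radical :=
      eq_of_elimIdeal_eq m r _ _ hr hrm (hhom Q hQ) (hprime Q hQ) (hdim Q hQ) (hhom Q' hQ')
        (hprime Q' hQ') (hdim Q' hQ') hspan
    have hdis := ht.distinct (Finset.mem_coe.2 hQ) (Finset.mem_coe.2 hQ') hne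
    apply hdis
    simp only [Submodule.colon_univ]
    exact heq
  -- the exponent law for each (homogeneous, isolated) component
  have hexp : ∀ Q ∈ t, ∀ F : MvPolynomial (Fin r × Fin (m + 1)) K,
      Ideal.span {F} = elimIdeal Q.radical r →
        Ideal.span {F ^ primaryExponent Q} = elimIdeal Q r := by
    intro Q hQ F hF
    have hQhom : Q.IsHomogeneous (homogeneousSubmodule (Fin (m + 1)) K) :=
      isHomogeneous_of_mem_isMinimalPrimaryDecomposition hI hunm ht hQ
    have hkQ : Q.radical ^ primaryExponent Q ≤ Q := radical_pow_primaryExponent_le Q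
    have hkmin : ∀ a, Q.radical ^ a ≤ Q → primaryExponent Q ≤ a := fun a ha => primaryExponent_le ha
    exact (elimIdeal_eq_span_pow_of_isPrimary (hprime Q hQ) (hhom Q hQ) hr (hdim Q hQ) (ht.primary hQ)
      hQhom rfl hF (primaryExponent_pos (ht.primary hQ).ne_top) hkQ hkmin).symm
  -- the product formula
  have hprod : ∀ F : Ideal (MvPolynomial (Fin (m + 1)) K) → MvPolynomial (Fin r × Fin (m + 1)) K,
      (∀ Q ∈ t, Ideal.span {F Q} = elimIdeal Q.radical r) →
        Ideal.span {∏ Q ∈ t, F Q ^ primaryExponent Q} = elimIdeal I r := by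
    intro F hF
    rw [elimIdeal_eq_iInf_of_isMinimalPrimaryDecomposition ht r,
      ← Nesterenko.iInf_span_singleton_pow_eq_span_prod t F
      (fun Q => primaryExponent Q) (hgenPrime F hF) (hgenNotDvd F hF)]
    refine iInf_congr fun Q => iInf_congr fun hQ => ?_
    exact hexp Q hQ (F Q) (hF Q hQ)
  refine ⟨?_, fun Q hQ => (hprinc Q hQ).1, fun F hF => ⟨?_, hprod F hF⟩, ?_⟩
  · -- principality of `Ī(r)`: use the generators `chowForm √Q r`
    have hF₀ : ∀ Q ∈ t, Ideal.span {chowForm Q.radical r} = elimIdeal Q.radical r :=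
      fun Q hQ => span_chowForm _ r (hprinc Q hQ).1
    rw [← hprod (fun Q => chowForm Q.radical r) hF₀]
    exact ⟨⟨_, rfl⟩⟩
  · intro Q hQ
    exact (hgenPrime F hF Q hQ).irreducible
  · intro i
    exact blockDeg_chowForm_eq_ideg I hr i

/-! ### Proposition 4.7 (1) over any field of characteristic zero -/

/-- **Proposition 4.4 for the chosen generators** (any field of characteristic zero): every
`chowForm √Q r`, `Q ∈ t`, is non-zero, and `chowForm I r = C c * ∏_{Q ∈ t} (chowForm √Q r)^{k_Q}`
for a non-zero `c ∈ K` (`k_Q` the exponent of `Q`). [cite: NesterenkoPhilippon2001, Ch. 3 Prop. 4.4 (p. 38)] -/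
theorem exists_chowForm_eq_C_mul_prod [CharZero K] {r : ℕ} {I : Ideal (MvPolynomial (Fin (m + 1)) K)}
    (hr1 : 1 ≤ r) (hrm : r ≤ m) (hIh : I.IsHomogeneous (homogeneousSubmodule (Fin (m + 1)) K))
    (hI : IsUnmixedOfRank I r) {t : Finset (Ideal (MvPolynomial (Fin (m + 1)) K))}
    (ht : Submodule.IsMinimalPrimaryDecomposition I t) :
    (∀ Q ∈ t, chowForm Q.radical r ≠ 0) ∧
      ∃ c : K, c ≠ 0 ∧
        chowForm I r = C c * ∏ Q ∈ t, chowForm Q.radical r ^ primaryExponent Q := by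
  obtain ⟨hPI, hPQ, hF, -⟩ := prop_4_4 m r I hr1 hrm hIh hI t ht
  have hspan : ∀ Q ∈ t, Ideal.span {chowForm Q.radical r} = elimIdeal Q.radical r :=
    fun Q hQ => span_chowForm _ _ (hPQ Q hQ)
  obtain ⟨hirr, hprod⟩ := hF (fun Q => chowForm Q.radical r) hspan
  refine ⟨fun Q hQ => (hirr Q hQ).ne_zero, ?_⟩
  rw [← span_chowForm I r hPI] at hprod
  obtain ⟨u, hu⟩ := Ideal.span_singleton_eq_span_singleton.mp hprod
  obtain ⟨c, hc, hcu⟩ := MvPolynomial.isUnit_iff_eq_C_of_isReduced.mp u.isUnit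
  exact ⟨c, hc.ne_zero, by rw [← hu, hcu, mul_comm]⟩

/-- The associated form of index `r ≥ 1` of any ideal is weighted-homogeneous of weight `deg I`
for the weight of each block `uᵢ` (any field of characteristic zero).
[cite: NesterenkoPhilippon2001, Ch. 3, remark after Prop. 4.4 (p. 38)] -/
theorem chowForm_isWeightedHomogeneous [CharZero K] (J : Ideal (MvPolynomial (Fin (m + 1)) K))
    {r : ℕ} (hr : 0 < r) (i : Fin r) :
    IsWeightedHomogeneous (fun v : Fin r × Fin (m + 1) => if v.1 = i then (1 : ℕ) else 0)
      (chowForm J r) (ideg J r) := by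
  intro γ hγ
  rw [Nesterenko.weight_block_eq_bdeg]
  exact bdeg_eq_ideg_of_mem_support_chowForm J hr (mem_support_iff.mpr hγ) i

/-- For a non-zero polynomial that is weighted-homogeneous of weight `n` for the weight of the
block `uᵢ`, the block degree `deg_{uᵢ}` is `n`. [folklore] -/
theorem blockDeg_eq_of_isWeightedHomogeneous {r : ℕ} {i : Fin r}
    {G : MvPolynomial (Fin r × Fin (m + 1)) K} {n : ℕ}
    (hG : IsWeightedHomogeneous (fun v : Fin r × Fin (m + 1) => if v.1 = i then (1 : ℕ) else 0) G n)
    (hG0 : G ≠ 0) : blockDeg G i = n := by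
  change G.support.sup (Nesterenko.bdeg i) = n
  apply le_antisymm
  · refine Finset.sup_le fun δ hδ => ?_
    rw [← Nesterenko.weight_block_eq_bdeg, hG (mem_support_iff.mp hδ)]
  · obtain ⟨δ, hδ⟩ : ∃ δ, coeff δ G ≠ 0 := exists_coeff_ne_zero hG0
    rw [← hG hδ, Nesterenko.weight_block_eq_bdeg]
    exact Finset.le_sup (f := Nesterenko.bdeg i) (mem_support_iff.mpr hδ)

/-- **LNM 1752 Ch. 3 Proposition 4.7 1) over an arbitrary field of characteristic zero.** Let
`I ⊂ K[x₀, …, x_m]` be a homogeneous unmixed ideal with `dim I = r − 1`, `1 ≤ r ≤ m`, `t` its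
reduced primary decomposition, `k_Q` the exponent of the component `Q`. Then
`∑_{Q ∈ t} k_Q · deg √Q = deg I` (degrees in the block `u₁` of the factorisation
`F_I = c ∏ F_{√Q}^{k_Q}` of Proposition 4.4). Over `ℚ` this is
`Nesterenko.sum_primaryExponent_mul_ideg_eq`. [cite: NesterenkoPhilippon2001, Ch. 3 Prop. 4.7 1) (p. 39)] -/
theorem sum_primaryExponent_mul_ideg_eq [CharZero K] {r : ℕ} {I : Ideal (MvPolynomial (Fin (m + 1)) K)}
    (hr1 : 1 ≤ r) (hrm : r ≤ m) (hIh : I.IsHomogeneous (homogeneousSubmodule (Fin (m + 1)) K))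
    (hI : IsUnmixedOfRank I r) {t : Finset (Ideal (MvPolynomial (Fin (m + 1)) K))}
    (ht : Submodule.IsMinimalPrimaryDecomposition I t) :
    ∑ Q ∈ t, primaryExponent Q * ideg Q.radical r = ideg I r := by
  have hr : 0 < r := hr1
  obtain ⟨hne, c, hc, hprod⟩ := exists_chowForm_eq_C_mul_prod hr1 hrm hIh hI ht
  set i₀ : Fin r := ⟨0, hr⟩
  set w : Fin r × Fin (m + 1) → ℕ := fun v => if v.1 = i₀ then 1 else 0
  set G : MvPolynomial (Fin r × Fin (m + 1)) K :=
    ∏ Q ∈ t, chowForm Q.radical r ^ primaryExponent Q with hG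
  -- `G` is block-homogeneous of weight `∑ k_Q deg √Q` in the block `u₁`, and non-zero
  have hGhom : IsWeightedHomogeneous w G
      (∑ Q ∈ t, primaryExponent Q * ideg Q.radical r) := by
    have h := IsWeightedHomogeneous.prod t (fun Q => chowForm Q.radical r ^ primaryExponent Q)
      (fun Q => primaryExponent Q * ideg Q.radical r) (w := w) (fun Q _ => by
        simpa [smul_eq_mul] using (chowForm_isWeightedHomogeneous Q.radical hr i₀).pow (primaryExponent Q))
    simpa [hG] using h
  have hG0 : G ≠ 0 := by
    rw [hG, Finset.prod_ne_zero_iff]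
    exact fun Q hQ => pow_ne_zero _ (hne Q hQ)
  -- hence so is `F_I = C c * G`
  have hFhom : IsWeightedHomogeneous w (chowForm I r)
      (∑ Q ∈ t, primaryExponent Q * ideg Q.radical r) := by
    rw [hprod]
    simpa using (isWeightedHomogeneous_C w c).mul hGhom
  have hF0 : chowForm I r ≠ 0 := by
    rw [hprod]
    exact mul_ne_zero (by simpa using hc) hG0
  have hideg : ideg I r = blockDeg (chowForm I r) i₀ := by
    rw [ideg, dif_pos hr]
  rw [hideg, blockDeg_eq_of_isWeightedHomogeneous hFhom hF0]

end NesterenkoK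

end Literature.NumberTheory.Transcendental

end
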